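import Summits.KontsevichZagierPeriods.Zeta5Search.PermutationSaving
import HarnessLib

/-!
# ζ(5) search — (29)–(30) permutation saving, part 2: `Forms28Perm` PROVED and the final `_holds` (census g16's proofs)

Filed by the lead lane (lit g9, 2026-08-20) from census g16's scratch file `HOME/pub-zeta5-census/xsave/g16/bc/PermutationSaving.lean`
(sha256 4d31a58b…), lines 349–468 VERBATIM (three one-line docstrings added, one unused-binder lint fix in `ev`); part 1 =
`PermutationSaving.lean` (nodes Π₁/Π₂/Φ, skeleton, `casoratianPermSymmetry_holds`, bookkeeping modulo `Forms28Perm`).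
RESULT: **`symmetricGaugeLaw_of_gaugeLaw28_holds : GaugeLaw28 → SymmetricGaugeLaw`** and `phiSaving_of_gaugeLaw28_holds` — the tree conjecture
`SymmetricGaugeLaw` (census g13 v2, p220337) is implied by the tree conjecture `GaugeLaw28`; with the tree's
`gaugeLaw28_of_symmetric_largePrime` the two coincide at `p² > m₁`.  Census bookkeeping: this changes no λ_proved (it orders two what-if
columns); certified irrationality candidates 0.

HONEST FRAMING: systematic search; no irrationality claim unless certified.
-/

namespace Summit.KontsevichZagierPeriods.Zeta5Search.SymmetricGauge

open Finset
open Summit.KontsevichZagierPeriods.Zeta5Search.CasoratianValuation (casoratian shift InPolytope)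
open Summit.KontsevichZagierPeriods.Zeta5Search.WedgeDictionary (dOf)

/-! ### `Forms28Perm` PROVED: relabelling permutes the 28 forms

The forms are indexed by a fixed SCHEME `scheme : List (Fin 7 ⊕ Sym2 (Fin 7))` (7 singles, 21 unordered pairs `j<k`):
`forms28 b = scheme.map (ev b)` (both sides unfold to the same explicit 28-entry list), `ev (σ•b) = ev b ∘ act σ`, and
`scheme.map (act σ) ~ scheme` (`Equiv.Perm.map_finRange_perm` on the singles; on the pairs `Sym2.map σ` is a
bijection of the off-diagonal of `Sym2 (Fin 7)`, membership decided by `decide`). -/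

section Forms28PermProof

open List

/-- Index scheme of the 28 forms. -/
abbrev Idx := Fin 7 ⊕ Sym2 (Fin 7)

/-- Evaluation of an index at `b`. -/
def ev (b : ℕ → ℤ) : Idx → ℤ
  | Sum.inl i => b (i.val + 1)
  | Sum.inr s => b 0 - Sym2.lift ⟨fun j k : Fin 7 => b (j.val + 1) + b (k.val + 1), fun _ _ => add_comm _ _⟩ s

/-- Relabelling acts on indices. -/
def act (σ : Equiv.Perm (Fin 7)) : Idx → Idx
  | Sum.inl i => Sum.inl (σ i)
  | Sum.inr s => Sum.inr (Sym2.map σ s)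

/-- The 21 pairs `j < k`, as a list of unordered pairs, in the order of `forms28`. -/
def pairIdx : List (Sym2 (Fin 7)) :=
  (finRange 7).flatMap fun j => ((finRange 7).filter fun k => j < k).map fun k => s(j, k)

/-- The scheme. -/
def scheme : List Idx := ((finRange 7).map Sum.inl) ++ pairIdx.map Sum.inr

/-- `ev (σ•b) = ev b ∘ act σ`. -/
theorem ev_permLower (σ : Equiv.Perm (Fin 7)) (b : ℕ → ℤ) (x : Idx) :
    ev (permLower σ b) x = ev b (act σ x) := by
  cases x with
  | inl i =>
    simp only [ev, act]
    have h : 1 ≤ i.val + 1 ∧ i.val + 1 ≤ 7 := ⟨by omega, by omega⟩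
    have e : (⟨i.val + 1 - 1, by omega⟩ : Fin 7) = i := Fin.ext (by simp)
    simp only [permLower, dif_pos h, e]
  | inr s =>
    induction s using Sym2.ind with
    | _ j k =>
      simp only [ev, act, Sym2.map_mk, Sym2.lift_mk]
      have h0 : permLower σ b 0 = b 0 := by simp [permLower]
      have hj : permLower σ b (j.val + 1) = b ((σ j).val + 1) := by
        have h : 1 ≤ j.val + 1 ∧ j.val + 1 ≤ 7 := ⟨by omega, by omega⟩
        have e : (⟨j.val + 1 - 1, by omega⟩ : Fin 7) = j := Fin.ext (by simp)
        simp only [permLower, dif_pos h, e]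
      have hk : permLower σ b (k.val + 1) = b ((σ k).val + 1) := by
        have h : 1 ≤ k.val + 1 ∧ k.val + 1 ≤ 7 := ⟨by omega, by omega⟩
        have e : (⟨k.val + 1 - 1, by omega⟩ : Fin 7) = k := Fin.ext (by simp)
        simp only [permLower, dif_pos h, e]
      rw [h0, hj, hk]

/-- `forms28 b` is the scheme evaluated at `b` (both sides unfolded to the explicit 28-entry list). -/
theorem forms28_eq_scheme (b : ℕ → ℤ) : forms28 b = scheme.map (ev b) := by
  have h7 : List.range 7 = [0, 1, 2, 3, 4, 5, 6] := by decide
  have f7 : List.finRange 7 = [0, 1, 2, 3, 4, 5, 6] := by decide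
  simp only [forms28, scheme, pairIdx, h7, f7, List.flatMap_cons, List.flatMap_nil, List.filter_cons, List.filter_nil,
    List.map_cons, List.map_nil, List.cons_append, List.nil_append, List.append_nil, ev]
  simp [Fin.lt_def, sub_sub, ev, Sym2.lift_mk]

/-- Membership in `pairIdx` = off-diagonal. -/
theorem mem_pairIdx_iff (s : Sym2 (Fin 7)) : s ∈ pairIdx ↔ ¬ s.IsDiag := by
  revert s; decide

/-- The 21 pairs are distinct. -/
theorem nodup_pairIdx : pairIdx.Nodup := by decide

/-- Relabelling permutes the scheme. -/
theorem scheme_perm (σ : Equiv.Perm (Fin 7)) : (scheme.map (act σ)).Perm scheme := by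
  unfold scheme
  rw [List.map_append, List.map_map, List.map_map]
  apply List.Perm.append
  · have : (Sum.inl ∘ σ : Fin 7 → Idx) = Sum.inl ∘ ⇑σ := rfl
    have h := (Equiv.Perm.map_finRange_perm σ).map (Sum.inl : Fin 7 → Idx)
    rw [List.map_map] at h
    exact h
  · have hcomp : (act σ ∘ Sum.inr : Sym2 (Fin 7) → Idx) = Sum.inr ∘ Sym2.map σ := by
      funext s; rfl
    rw [hcomp, ← List.map_map]
    apply List.Perm.map
    rw [List.perm_ext_iff_of_nodup (nodup_pairIdx.map (Sym2.map.injective σ.injective)) nodup_pairIdx]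
    intro z
    rw [List.mem_map, mem_pairIdx_iff]
    constructor
    · rintro ⟨s, hs, rfl⟩
      rw [mem_pairIdx_iff] at hs
      rwa [Sym2.isDiag_map σ.injective]
    · intro hz
      refine ⟨Sym2.map σ.symm z, ?_, ?_⟩
      · rw [mem_pairIdx_iff, Sym2.isDiag_map σ.symm.injective]; exact hz
      · rw [Sym2.map_map, Equiv.self_comp_symm, Sym2.map_id, id]

/-- **`Forms28Perm` PROVED.** -/
theorem forms28_perm (b : ℕ → ℤ) (σ : Equiv.Perm (Fin 7)) :
    (forms28 (permLower σ b)).Perm (forms28 b) := by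
  rw [forms28_eq_scheme, forms28_eq_scheme]
  have e : ev (permLower σ b) = ev b ∘ act σ := funext (ev_permLower σ b)
  rw [e, ← List.map_map]
  exact (scheme_perm σ).map (ev b)


/-- **`Forms28Perm` PROVED.** -/
theorem forms28Perm_holds : Forms28Perm := forms28_perm

/-- **NODE Π₂ PROVED.** -/
theorem gaugeDataPermInvariant_holds : GaugeDataPermInvariant :=
  gaugeDataPermInvariant_of_forms28Perm forms28Perm_holds

/-- **THE (29)–(30) SAVING IS A THEOREM GIVEN (28) FOR ALL LABELLINGS (census g16, PROVED):**
typed `GaugeLaw28` ⟹ `SymmetricGaugeLaw` (⟺ `PhiSaving`).  With `gaugeLaw28_of_symmetric_largePrime` (tree) the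
two typed conjectures coincide at `p² > m₁`. -/
theorem symmetricGaugeLaw_of_gaugeLaw28_holds (h28 : GaugeLaw28) : SymmetricGaugeLaw :=
  symmetricGaugeLaw_of_gaugeLaw28 casoratianPermSymmetry_holds gaugeDataPermInvariant_holds h28

/-- **`GaugeLaw28 → PhiSaving`** (BZ's own shape of (29)–(30)). -/
theorem phiSaving_of_gaugeLaw28_holds (h28 : GaugeLaw28) : PhiSaving :=
  phiSaving_iff_symmetricGaugeLaw.2 (symmetricGaugeLaw_of_gaugeLaw28_holds h28)

end Forms28PermProof

end Summit.KontsevichZagierPeriods.Zeta5Search.SymmetricGauge
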